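import Mathlib

/-!
# Beta / Interp330 — BINDER-OWNERS row D4, co-owner road P2′: the t·g_k INTERPOLATION IDENTITY of [Balaban1988Convergent]
# (3.30) p. 272 in ABSTRACT KERNEL FORM — «log of the fluctuation integral = log of the Gaussian normalization + g_k·∫₀¹⟨insertion⟩_t dt»
# (β sub-cell, unit `b2b-balaban-beta-d4-p2`, generation 1; NODE S (leaves S.1–S.3) of `HOME/beta/skeletons/D4-b2b-balaban-beta-d4-p2.md`)

HONEST FRAMING (page 1 of everything the β sub-cell writes): discharging `BetaPertH` makes Bałaban's UV stability
UNCONDITIONAL — a real constructive-QFT result; it is NOT the continuum limit and NOT the Clay problem.  HONEST DEPENDENCY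
(cell reorg 2026-08-19, verbatim): «continuum YM on T⁴ ⇐ BetaPertH ∧ nine spine estimates (0/9 proved); BetaPertH ⇐ (D1) ∧
(D4) ∧ CAP+tail; G-an2-4 gates asym, D1 and NE2/3/4.»  THIS MODULE INSTANTIATES NO BINDER AND ASSERTS NOTHING ABOUT
BAŁABAN'S β-FUNCTIONS; it is calculus (the fundamental theorem of calculus for the logarithm of a positive C¹ family,
differentiation under the integral sign for a bounded C¹ integrand on a finite measure space, the chain rule producing the
factor `g`), proved from Mathlib with no `sorry` and no new axiom.

ABSOLUTE RULE (cell charter, verbatim): "No internally-minted statement may enter as a cited fact. Every hypothesis is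
either kernel-proved in this package or a verbatim quotation of a PUBLISHED theorem with page reference. The manuscript(s)
under audit are NOT citable for their own disputed steps — they are the thing under adjudication; programme-internal
(2001/route/tribunal) claims are never citable."  Nothing is cited as a fact here.

## The printed text and what is typed

[III] = [Balaban1988Convergent], CMP **119** (1988), p. 272 [PDF 30] (render `…-p030-x2.png` READ AS AN IMAGE by this
seat), verbatim: *«To get the representation (2.26), (2.27) we expand this expression with respect to g_k up to the first
order. The idea is that this expansion is obtained by expanding the underintegral expression in g_kCA, because of the special
structure of these expressions. … Multiplying g_k by the parameter t we have
  [the logarithm on the right-hand side of (3.28)] = log[z^{(k)}∫dA exp[−½⟨A,C*Δ^{(k)}CA⟩]] + log∫dμ_{C^{(k)}(Λ_{k+1})}χ^{(k)}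
     + g_k∫₀¹dt ⟨∂/∂tg_k 𝐏^{(k)}(tg_k,A) + ∂/∂tg_k 𝐄_k(U_k(…tg_kCA…))⟩_t ,   (3.30)
where the expectation value is with respect to the probabilistic measure defined by the function χ^{(k)}exp[…tg_k…] in the
logarithm, but with the constant g_k replaced by tg_k.»*  (The logarithm on the right-hand side of (3.28) is
`log[z^{(k)}∫dAχ^{(k)}exp[−½⟨A,C*Δ^{(k)}CA⟩ + 𝐏^{(k)}(g_k,A) + {𝐄_k(U_k(exp i[g_kCA − hD̃(g_kCA)]V^{(k)})) − 𝐄_k(U_{k+1})}]]`,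
p. 272 (3.28); at g = 0 both 𝐏^{(k)}(0,·) and the curly bracket vanish — [I] p. 268 after (2.13) «the expression under
the exponential above vanishes at g_k = 0», (3.31) p. 273 «We use the fact that the lower-order terms vanish».)

TYPED (abstract form — the finite-dimensional fluctuation integral is any finite measure space `(Ω, μ)`, the χ-cut Gaussian
weight and the interaction are real functions on it):
* §1 `log_sub_log_eq_integral` — S.1: for a family `Z : ℝ → ℝ`, positive with a continuous derivative `Z′` on `[0,1]`:
  `log Z 1 − log Z 0 = ∫₀¹ Z′ t / Z t dt` (FTC for `log ∘ Z`).
* §2 `hasDerivAt_integral_of_bounded` — S.2: for `F, F′ : ℝ → Ω → ℝ` with `t ↦ F t ω` differentiable with derivative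
  `F′ t ω` for every ω, `F t`, `F′ t` a.e.-strongly measurable for every t, and ONE uniform bound `‖F′ t ω‖ ≤ K` (the
  small-field characteristic function has bounded support; [III]'s integrand is bounded there), on a FINITE measure:
  `HasDerivAt (t ↦ ∫ F t dμ) (∫ F′ t dμ) t` at every t, and `t ↦ ∫ F′ t dμ` is the derivative.
* §3 `interp330` — S.3, the three-term identity with THE FACTOR g: for the weight `F t ω = χ ω · exp (Ψ (t·g) ω)` with
  `s ↦ Ψ s ω` differentiable (derivative `Ψ′ s ω`), `Ψ 0 = 0` (the interaction and the curly bracket vanish at zero coupling),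
  χ, Ψ, Ψ′ bounded and measurable as stated:
  `log ∫ χ·exp(Ψ g) dμ = log ∫ χ dμ + g · ∫₀¹ ⟨Ψ′(t g)⟩_t dt`,  `⟨f⟩_t := (∫ χ·f·exp(Ψ(tg)) dμ) / (∫ χ·exp(Ψ(tg)) dμ)`
  — literally (3.30) with `log ∫χ dμ` = its first two summands (the Gaussian normalization is inside μ here) and
  `Ψ s = 𝐏^{(k)}(s,·) + {𝐄_k(U_k(…s CA…)) − 𝐄_k(U_{k+1})}`, `Ψ′ = ∂/∂s` of it = [III] (3.31)'s `⟨𝐕′_k(s,A), CA⟩`.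
NOT typed here: (3.32) p. 273 (the same device applied to the SHARP characteristic functions χ_t^{(k)} — a surface-measure
formula, not a classical derivative; cell GAPS C-adv5-22 computes it at reader level; with a smooth cut-off §2 applies
verbatim); the localized expansions (3.44)–(3.47) of ⟨·⟩_t (skeleton NODES A′, R).  NOT CLAIMED: anything about Bałaban's
integrals beyond this calculus; NOT BetaPertH, NOT continuum, NOT Clay.
-/

namespace Summit.QuantumFields.BalabanUV.Beta.Interp330

open MeasureTheory Filter Topology Set intervalIntegral

noncomputable section

/-! ## §1 S.1 — the logarithm of a positive C¹ family: FTC -/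

/-- **S.1** `log Z(1) − log Z(0) = ∫₀¹ Z′/Z`, for `Z` with derivative `Z′` at every point of `[0,1]`, `Z > 0` there and
`Z′` continuous there.  ([III] (3.30)'s «∫₀¹dt» is this identity for the fluctuation integral as a function of the
interpolation parameter.) -/
theorem log_sub_log_eq_integral {Z Z' : ℝ → ℝ} (hZ : ∀ t ∈ uIcc (0 : ℝ) 1, HasDerivAt Z (Z' t) t)
    (hpos : ∀ t ∈ uIcc (0 : ℝ) 1, 0 < Z t) (hZ'c : ContinuousOn Z' (uIcc (0 : ℝ) 1)) :
    Real.log (Z 1) - Real.log (Z 0) = ∫ t in (0 : ℝ)..1, Z' t / Z t := by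
  have hderiv : ∀ t ∈ uIcc (0 : ℝ) 1, HasDerivAt (fun s => Real.log (Z s)) (Z' t / Z t) t := fun t ht =>
    (hZ t ht).log (hpos t ht).ne'
  have hZc : ContinuousOn Z (uIcc (0 : ℝ) 1) := HasDerivAt.continuousOn hZ
  have hint : IntervalIntegrable (fun t => Z' t / Z t) volume (0 : ℝ) 1 := by
    apply ContinuousOn.intervalIntegrable
    exact hZ'c.div hZc fun t ht => (hpos t ht).ne'
  rw [integral_eq_sub_of_hasDerivAt hderiv hint]

/-! ## §2 S.2 — differentiation under the integral sign, bounded C¹ integrand, finite measure -/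

variable {Ω : Type*} [MeasurableSpace Ω] {μ : Measure Ω}

/-- **S.2** For `F, F′ : ℝ → Ω → ℝ` with `HasDerivAt (F · ω) (F′ t ω) t` for all t, ω, every `F t` and `F′ t`
a.e.-strongly measurable, and a UNIFORM bound `|F′ t ω| ≤ K`, on a finite measure: the parametric integral
`t ↦ ∫ F t dμ` has derivative `∫ F′ t dμ` at every `t`, provided `F t₀` is integrable for one (hence every) `t₀` — here we
ask integrability of every `F t` directly (bounded support of χ in the application). -/
theorem hasDerivAt_integral_of_bounded [IsFiniteMeasure μ] {F F' : ℝ → Ω → ℝ} {K : ℝ}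
    (hF_meas : ∀ t, AEStronglyMeasurable (F t) μ) (hF_int : ∀ t, Integrable (F t) μ)
    (hF'_meas : ∀ t, AEStronglyMeasurable (F' t) μ) (hbound : ∀ t ω, |F' t ω| ≤ K)
    (hdiff : ∀ ω t, HasDerivAt (fun s => F s ω) (F' t ω) t) (t₀ : ℝ) :
    HasDerivAt (fun t => ∫ ω, F t ω ∂μ) (∫ ω, F' t₀ ω ∂μ) t₀ := by
  have h := hasDerivAt_integral_of_dominated_loc_of_deriv_le (μ := μ) (F := F) (x₀ := t₀) (s := univ)
    (bound := fun _ => K) Filter.univ_mem (Filter.Eventually.of_forall hF_meas) (hF_int t₀) (hF'_meas t₀)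
    (Filter.Eventually.of_forall fun ω t _ => by simpa [Real.norm_eq_abs] using hbound t ω)
    (integrable_const K) (Filter.Eventually.of_forall fun ω t _ => hdiff ω t)
  exact h.2

/-! ## §3 S.3 — the three-term identity (3.30) with the factor `g`

Setting: a finite measure `μ` on `Ω` (the Gaussian fluctuation measure, normalization included), a cut-off `χ : Ω → ℝ`
with `0 ≤ χ ≤ 1`, measurable, `∫χ dμ > 0`; an «interaction» `Ψ : ℝ → Ω → ℝ` (coupling ↦ configuration ↦ value) with
`Ψ 0 = 0`, `s ↦ Ψ s ω` differentiable with derivative `Ψ′ s ω`, and uniform bounds `|Ψ s ω| ≤ B`, `|Ψ′ s ω| ≤ B′` (on the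
support of χ this is what the small-field restriction buys; outside it χ = 0 kills everything, so we simply ask the bounds
globally of the typed functions), measurable in ω for each s. -/

/-- The interpolated weight `F_g(t, ω) = χ(ω)·exp(Ψ(t·g, ω))`. -/
def weight (χ : Ω → ℝ) (Ψ : ℝ → Ω → ℝ) (g t : ℝ) (ω : Ω) : ℝ := χ ω * Real.exp (Ψ (t * g) ω)

/-- Its t-derivative `χ(ω)·g·Ψ′(t·g, ω)·exp(Ψ(t·g, ω))` — the factor `g` is the chain rule. -/
def dweight (χ : Ω → ℝ) (Ψ Ψ' : ℝ → Ω → ℝ) (g t : ℝ) (ω : Ω) : ℝ :=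
  χ ω * (g * Ψ' (t * g) ω) * Real.exp (Ψ (t * g) ω)

/-- The interpolated partition function `Z_g(t) = ∫ χ·exp(Ψ(tg)) dμ`. -/
def Zfun (μ : Measure Ω) (χ : Ω → ℝ) (Ψ : ℝ → Ω → ℝ) (g t : ℝ) : ℝ := ∫ ω, weight χ Ψ g t ω ∂μ

/-- The interpolated (un-normalized) insertion integral `∫ χ·f·exp(Ψ(tg)) dμ`. -/
def ins (μ : Measure Ω) (χ : Ω → ℝ) (Ψ : ℝ → Ω → ℝ) (g t : ℝ) (f : Ω → ℝ) : ℝ :=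
  ∫ ω, χ ω * f ω * Real.exp (Ψ (t * g) ω) ∂μ

/-- The expectation `⟨f⟩_t` of [III] (3.30): «with respect to the probabilistic measure defined by the function χ^{(k)}exp[…tg_k…]». -/
def expect (μ : Measure Ω) (χ : Ω → ℝ) (Ψ : ℝ → Ω → ℝ) (g t : ℝ) (f : Ω → ℝ) : ℝ :=
  ins μ χ Ψ g t f / Zfun μ χ Ψ g t

omit [MeasurableSpace Ω] in
/-- Chain rule: `t ↦ χ ω·exp(Ψ(tg) ω)` has derivative `dweight` at every t. -/
theorem hasDerivAt_weight (χ : Ω → ℝ) {Ψ Ψ' : ℝ → Ω → ℝ} (hΨ : ∀ ω s, HasDerivAt (fun r => Ψ r ω) (Ψ' s ω) s)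
    (g t : ℝ) (ω : Ω) : HasDerivAt (fun s => weight χ Ψ g s ω) (dweight χ Ψ Ψ' g t ω) t := by
  unfold weight dweight
  have h1 : HasDerivAt (fun s : ℝ => s * g) g t := by simpa using (hasDerivAt_id t).mul_const g
  have h2 : HasDerivAt (fun s : ℝ => Ψ (s * g) ω) (Ψ' (t * g) ω * g) t := by
    have := (hΨ ω (t * g)).comp t h1
    simpa [Function.comp_def] using this
  have h3 : HasDerivAt (fun s : ℝ => Real.exp (Ψ (s * g) ω)) (Real.exp (Ψ (t * g) ω) * (Ψ' (t * g) ω * g)) t :=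
    h2.exp
  exact (h3.const_mul (χ ω)).congr_deriv (by ring)

omit [MeasurableSpace Ω] in
/-- The weight is bounded by `exp B` when `0 ≤ χ ≤ 1`, `|Ψ| ≤ B`. -/
theorem abs_weight_le {χ : Ω → ℝ} {Ψ : ℝ → Ω → ℝ} {B : ℝ} (hχ0 : ∀ ω, 0 ≤ χ ω) (hχ1 : ∀ ω, χ ω ≤ 1)
    (hΨ : ∀ s ω, |Ψ s ω| ≤ B) (g t : ℝ) (ω : Ω) : |weight χ Ψ g t ω| ≤ Real.exp B := by
  unfold weight
  rw [abs_mul, abs_of_nonneg (hχ0 ω), Real.abs_exp]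
  calc χ ω * Real.exp (Ψ (t * g) ω) ≤ 1 * Real.exp B := by
        apply mul_le_mul (hχ1 ω) (Real.exp_le_exp.2 (le_of_abs_le (hΨ _ _))) (Real.exp_pos _).le zero_le_one
    _ = Real.exp B := one_mul _

omit [MeasurableSpace Ω] in
/-- The derivative weight is bounded by `|g|·B′·exp B`. -/
theorem abs_dweight_le {χ : Ω → ℝ} {Ψ Ψ' : ℝ → Ω → ℝ} {B B' : ℝ} (hχ0 : ∀ ω, 0 ≤ χ ω) (hχ1 : ∀ ω, χ ω ≤ 1)
    (hΨ : ∀ s ω, |Ψ s ω| ≤ B) (hΨ' : ∀ s ω, |Ψ' s ω| ≤ B') (g t : ℝ) (ω : Ω) :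
    |dweight χ Ψ Ψ' g t ω| ≤ |g| * B' * Real.exp B := by
  unfold dweight
  have hB' : 0 ≤ B' := le_trans (abs_nonneg _) (hΨ' 0 ω)
  rw [abs_mul, abs_mul, abs_mul, abs_of_nonneg (hχ0 ω), Real.abs_exp]
  calc χ ω * (|g| * |Ψ' (t * g) ω|) * Real.exp (Ψ (t * g) ω)
      ≤ 1 * (|g| * B') * Real.exp B := by
        apply mul_le_mul _ (Real.exp_le_exp.2 (le_of_abs_le (hΨ _ _))) (Real.exp_pos _).le (by positivity)
        exact mul_le_mul (hχ1 ω) (mul_le_mul_of_nonneg_left (hΨ' _ _) (abs_nonneg g)) (by positivity) zero_le_one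
    _ = |g| * B' * Real.exp B := by ring

/-- [folklore] Hypotheses of §3 packaged: cut-off in `[0,1]` with positive mass, bounded measurable interaction, C¹ in
the coupling (derivative `Ψ′` bounded and continuous in the coupling), vanishing at zero coupling.  A HYPOTHESIS structure
about abstract functions (no printed object is asserted to satisfy it). -/
structure InterpData (μ : Measure Ω) (χ : Ω → ℝ) (Ψ Ψ' : ℝ → Ω → ℝ) (B B' : ℝ) : Prop where
  χ_nonneg : ∀ ω, 0 ≤ χ ω
  χ_le_one : ∀ ω, χ ω ≤ 1
  χ_meas : Measurable χ
  χ_mass : 0 < ∫ ω, χ ω ∂μ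
  Ψ_zero : ∀ ω, Ψ 0 ω = 0
  Ψ_meas : ∀ s, Measurable (Ψ s)
  Ψ'_meas : ∀ s, Measurable (Ψ' s)
  Ψ_deriv : ∀ ω s, HasDerivAt (fun r => Ψ r ω) (Ψ' s ω) s
  Ψ_bound : ∀ s ω, |Ψ s ω| ≤ B
  Ψ'_bound : ∀ s ω, |Ψ' s ω| ≤ B'
  Ψ'_cont : ∀ ω, Continuous fun s => Ψ' s ω

variable [IsFiniteMeasure μ] {χ : Ω → ℝ} {Ψ Ψ' : ℝ → Ω → ℝ} {B B' : ℝ}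

omit [IsFiniteMeasure μ] in
/-- Measurability of the weight. -/
theorem measurable_weight (D : InterpData μ χ Ψ Ψ' B B') (g t : ℝ) : Measurable (weight χ Ψ g t) := by
  unfold weight
  exact D.χ_meas.mul (D.Ψ_meas _).exp

omit [IsFiniteMeasure μ] in
/-- Measurability of the derivative weight. -/
theorem measurable_dweight (D : InterpData μ χ Ψ Ψ' B B') (g t : ℝ) : Measurable (dweight χ Ψ Ψ' g t) := by
  unfold dweight
  exact (D.χ_meas.mul ((D.Ψ'_meas _).const_mul g)).mul (D.Ψ_meas _).exp

/-- Integrability of the weight (bounded measurable on a finite measure). -/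
theorem integrable_weight (D : InterpData μ χ Ψ Ψ' B B') (g t : ℝ) : Integrable (weight χ Ψ g t) μ :=
  Integrable.of_bound (measurable_weight D g t).aestronglyMeasurable (Real.exp B)
    (Filter.Eventually.of_forall fun ω => by
      rw [Real.norm_eq_abs]; exact abs_weight_le D.χ_nonneg D.χ_le_one D.Ψ_bound g t ω)

/-- Integrability of the derivative weight. -/
theorem integrable_dweight (D : InterpData μ χ Ψ Ψ' B B') (g t : ℝ) : Integrable (dweight χ Ψ Ψ' g t) μ :=
  Integrable.of_bound (measurable_dweight D g t).aestronglyMeasurable (|g| * B' * Real.exp B)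
    (Filter.Eventually.of_forall fun ω => by
      rw [Real.norm_eq_abs]; exact abs_dweight_le D.χ_nonneg D.χ_le_one D.Ψ_bound D.Ψ'_bound g t ω)

/-- **S.2 applied**: `Z_g′(t) = ∫ dweight(t) dμ`. -/
theorem hasDerivAt_Zfun (D : InterpData μ χ Ψ Ψ' B B') (g t : ℝ) :
    HasDerivAt (Zfun μ χ Ψ g) (∫ ω, dweight χ Ψ Ψ' g t ω ∂μ) t :=
  hasDerivAt_integral_of_bounded (K := |g| * B' * Real.exp B)
    (fun s => (measurable_weight D g s).aestronglyMeasurable) (integrable_weight D g)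
    (fun s => (measurable_dweight D g s).aestronglyMeasurable)
    (fun s ω => abs_dweight_le D.χ_nonneg D.χ_le_one D.Ψ_bound D.Ψ'_bound g s ω)
    (fun ω s => hasDerivAt_weight χ D.Ψ_deriv g s ω) t

/-- `Z_g(t) > 0`: the weight is `≥ χ·e^{−B} ≥ 0` pointwise and `∫χ > 0`. -/
theorem Zfun_pos (D : InterpData μ χ Ψ Ψ' B B') (g t : ℝ) : 0 < Zfun μ χ Ψ g t := by
  unfold Zfun
  have hχint : Integrable χ μ :=
    Integrable.of_bound D.χ_meas.aestronglyMeasurable 1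
      (Filter.Eventually.of_forall fun ω => by
        rw [Real.norm_eq_abs, abs_of_nonneg (D.χ_nonneg ω)]; exact D.χ_le_one ω)
  have hle : ∫ ω, Real.exp (-B) * χ ω ∂μ ≤ ∫ ω, weight χ Ψ g t ω ∂μ := by
    refine integral_mono (hχint.const_mul _) (integrable_weight D g t) fun ω => ?_
    show Real.exp (-B) * χ ω ≤ weight χ Ψ g t ω
    unfold weight
    have h1 : Real.exp (-B) ≤ Real.exp (Ψ (t * g) ω) := Real.exp_le_exp.2 (neg_le_of_abs_le (D.Ψ_bound _ _))
    have h2 := D.χ_nonneg ω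
    nlinarith
  rw [MeasureTheory.integral_const_mul] at hle
  exact lt_of_lt_of_le (mul_pos (Real.exp_pos _) D.χ_mass) hle

omit [IsFiniteMeasure μ] in
/-- At `t = 0` the weight is the bare cut-off (since `Ψ 0 = 0`): `Z_g(0) = ∫ χ dμ` — [III]'s «first two summands»
(the Gaussian normalization being inside μ here). -/
theorem Zfun_zero (D : InterpData μ χ Ψ Ψ' B B') (g : ℝ) : Zfun μ χ Ψ g 0 = ∫ ω, χ ω ∂μ := by
  unfold Zfun weight
  congr 1; funext ω
  rw [zero_mul, D.Ψ_zero, Real.exp_zero, mul_one]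

omit [IsFiniteMeasure μ] in
/-- At `t = 1` the weight is the full interacting weight at coupling `g`. -/
theorem Zfun_one (g : ℝ) : Zfun μ χ Ψ g 1 = ∫ ω, χ ω * Real.exp (Ψ g ω) ∂μ := by
  unfold Zfun weight; simp

omit [IsFiniteMeasure μ] in
/-- The derivative integral IS `g` times the un-normalized insertion of `Ψ′(tg)`: `∫ dweight(t) = g · ins(t, Ψ′(tg))`. -/
theorem integral_dweight_eq (g t : ℝ) :
    ∫ ω, dweight χ Ψ Ψ' g t ω ∂μ = g * ins μ χ Ψ g t (Ψ' (t * g)) := by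
  unfold dweight ins
  rw [← MeasureTheory.integral_const_mul]
  congr 1; funext ω; ring

/-- Continuity in `t` of the derivative integral (needed for the FTC): dominated convergence with the constant bound,
the integrand being continuous in `t` for each ω (Ψ continuous as a differentiable function, Ψ′ continuous by hypothesis). -/
theorem continuous_integral_dweight (D : InterpData μ χ Ψ Ψ' B B') (g : ℝ) :
    Continuous fun t => ∫ ω, dweight χ Ψ Ψ' g t ω ∂μ := by
  apply continuous_of_dominated (bound := fun _ => |g| * B' * Real.exp B)
  · exact fun t => (measurable_dweight D g t).aestronglyMeasurable
  · exact fun t => Filter.Eventually.of_forall fun ω => by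
      rw [Real.norm_eq_abs]; exact abs_dweight_le D.χ_nonneg D.χ_le_one D.Ψ_bound D.Ψ'_bound g t ω
  · exact integrable_const _
  · refine Filter.Eventually.of_forall fun ω => ?_
    have hsg : Continuous fun s : ℝ => s * g := continuous_id.mul continuous_const
    have hc : Continuous fun s : ℝ => Ψ (s * g) ω :=
      (continuous_iff_continuousAt.2 fun s => (D.Ψ_deriv ω s).continuousAt).comp hsg
    have hc' : Continuous fun s : ℝ => Ψ' (s * g) ω := (D.Ψ'_cont ω).comp hsg
    unfold dweight
    exact (continuous_const.mul (continuous_const.mul hc')).mul (Real.continuous_exp.comp hc)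

/-- **S.3 = [III] (3.30) IN ABSTRACT FORM.**  For the χ-cut weight with interaction `Ψ(g)` vanishing at zero coupling,
`log ∫ χ·e^{Ψ(g)} dμ − log ∫ χ dμ = g · ∫₀¹ ⟨Ψ′(t·g)⟩_t dt`, where `⟨f⟩_t = (∫ χ f e^{Ψ(tg)} dμ)/(∫ χ e^{Ψ(tg)} dμ)` is the
expectation «with respect to the probabilistic measure defined by the function χ exp[…tg…] … with the constant g replaced by
tg».  The factor `g` in front is the chain rule `d/dt Ψ(tg) = g·Ψ′(tg)`; nothing else produces it. -/
theorem interp330 (D : InterpData μ χ Ψ Ψ' B B') (g : ℝ) :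
    Real.log (∫ ω, χ ω * Real.exp (Ψ g ω) ∂μ) - Real.log (∫ ω, χ ω ∂μ) =
      g * ∫ t in (0 : ℝ)..1, expect μ χ Ψ g t (Ψ' (t * g)) := by
  have S1 := log_sub_log_eq_integral (Z := Zfun μ χ Ψ g) (Z' := fun t => ∫ ω, dweight χ Ψ Ψ' g t ω ∂μ)
    (fun t _ => hasDerivAt_Zfun D g t) (fun t _ => Zfun_pos D g t) (continuous_integral_dweight D g).continuousOn
  rw [Zfun_one, Zfun_zero D] at S1
  rw [S1, ← intervalIntegral.integral_const_mul]
  congr 1; funext t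
  rw [integral_dweight_eq]
  unfold expect
  ring

/-- The same identity solved for the interacting integral: `log ∫χe^{Ψ(g)} = log ∫χ + g·∫₀¹⟨Ψ′(tg)⟩_t dt` —
[III] (3.30) read as «Gaussian-with-cut-off normalization + g_k × (interaction insertion)»; with a further split of
`log ∫χ dμ = log μ(Ω) + log(∫χ dμ/μ(Ω))` one recovers the three printed summands. -/
theorem log_integral_eq_interp (D : InterpData μ χ Ψ Ψ' B B') (g : ℝ) :
    Real.log (∫ ω, χ ω * Real.exp (Ψ g ω) ∂μ) =
      Real.log (∫ ω, χ ω ∂μ) + g * ∫ t in (0 : ℝ)..1, expect μ χ Ψ g t (Ψ' (t * g)) := by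
  have := interp330 D g
  linarith

/-- **The bound that road P2′ feeds downstream**: if the insertion's expectation is bounded UNIFORMLY in t,
`|⟨Ψ′(tg)⟩_t| ≤ I` for `t ∈ [0,1]`, then the beyond-normalization part of the logarithm is at most `|g|·I` — «the
multiplication by g_k yields small bounds» ([III] p. 278 l. 17–18) in its abstract form. -/
theorem abs_log_sub_log_le (D : InterpData μ χ Ψ Ψ' B B') (g : ℝ) {I : ℝ}
    (hI : ∀ t ∈ uIcc (0 : ℝ) 1, |expect μ χ Ψ g t (Ψ' (t * g))| ≤ I) :
    |Real.log (∫ ω, χ ω * Real.exp (Ψ g ω) ∂μ) - Real.log (∫ ω, χ ω ∂μ)| ≤ |g| * I := by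
  rw [interp330 D g, abs_mul]
  apply mul_le_mul_of_nonneg_left _ (abs_nonneg g)
  have h := intervalIntegral.norm_integral_le_of_norm_le_const (a := (0 : ℝ)) (b := 1)
    (f := fun t => expect μ χ Ψ g t (Ψ' (t * g))) (C := I)
    (fun t ht => by
      rw [Real.norm_eq_abs]
      exact hI t (uIoc_subset_uIcc ht))
  simpa using h

end

end Summit.QuantumFields.BalabanUV.Beta.Interp330
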